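import Mathlib
import Summits.Langlands.Langlands.Theorems.ParityBlindBianchiIcosahedralQuadraticDescentFrobRoots
import Literature.NumberTheory.Automorphic.TunnellLemma
import Literature.NumberTheory.Automorphic.BaseChangeStrongUnramified
import Literature.NumberTheory.Automorphic.TunnellOctahedralGlobalProofs
import Literature.NumberTheory.Automorphic.AutomorphicRepsGLSatakeFlathProofs

/-!
# Icosahedral descent (crux `IcosahedralDescentLevel`, line `Sketch`) — descent along the anchor

Uniform quadratic descent for an Artin representation `ρ : Γ_ℚ → GL₂(ℂ)`, the anchor step.
`K₁/ℚ` is a quadratic Galois extension, `P₁` a cuspidal representation of `GL₂(𝔸_{K₁})` which is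
`π(ρ|_{K₁})` almost everywhere (`IsPiOfArtinRep`) and at every place over the witness place `v₁`
(`FrobSatakeCompatibleAt`); `v₁` is unramified and split in `K₁` (every place above it has residue
degree `1`), `ρ` is unramified at `v₁` with Frobenius roots `{1, 1}`.  Then:

* (i) cyclic descent of prime degree (the named fact `cuspidal_descent_cyclic`, Arthur–Clozel
  III.4.2 (d)) applied to `P₁`, whose Satake data are `Gal(K₁/ℚ)`-stable
  (`isGaloisStableSatakeAE_of_isPiOfArtinRep`), gives a cuspidal `π` on `GL₂(𝔸_ℚ)` of which `P₁` is
  a weak base change lift;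
* (ii) strong lifting at the places unramified in `K₁` (the named fact
  `ArthurClozel1989_strongLifting_unramified`, A–C III.5.1) makes `π` unramified at `v₁` with
  `t_{π,v₁}^{f(w|v₁)} = t_{P₁,w} = β^{f(w|v₁)}` for a place `w ∣ v₁`, `β = {1, 1}` the Frobenius roots
  and `f(w|v₁) = 1`, so `t_{π,v₁} = {1, 1}` exactly;
* (iii) the proved twist fact `exists_twist_quadraticSign_holds` gives `π♭ = π ⊗ η_{K₁/ℚ}` with
  Satake parameters `ε_{K₁/ℚ}(v) t_{π,v}` almost everywhere.
-/

-- `Summit.Langlands.Langlands.…`: the repeated path component is the tree's layout (D-0017).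
set_option linter.dupNamespace false

noncomputable section

open scoped MatrixGroups NumberField Polynomial Classical
open NumberField IsDedekindDomain Field Filter
open Literature.NumberTheory.Automorphic Literature.NumberTheory.GaloisRepresentations
open Summit.Langlands.Langlands.Theorems.IcosahedralQuadraticDescent

namespace Summit.Langlands.Langlands.Theorems.IcosahedralDescentLevel

/-- **Descent along the anchor field and the witness place.**  Given cuspidal `P₁` on
`GL₂(𝔸_{K₁})`, `[K₁ : ℚ] = 2` Galois, compatible with `ρ|_{K₁}` almost everywhere and at every
place over `v₁`, where `v₁` is unramified in `K₁` with all places above it of residue degree `1`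
and `ρ` is unramified at `v₁` with Frobenius roots `{1, 1}`: cyclic descent
(`cuspidal_descent_cyclic`) gives a cuspidal `π` on `GL₂(𝔸_ℚ)` of which `P₁` is a weak lift,
strong lifting at unramified places (`ArthurClozel1989_strongLifting_unramified`) gives
`t_{π,v₁} = {1, 1}` exactly, and the proved twist fact gives `π♭ = π ⊗ η_{K₁/ℚ}`. [folklore] -/
theorem anchor_descent (hdesc : cuspidal_descent_cyclic) (hSL : ArthurClozel1989_strongLifting_unramified)
    (ρ : FramedArtinRep ℚ 2) (K₁ : Type) [Field K₁] [NumberField K₁] [IsGalois ℚ K₁]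
    (h2 : Module.finrank ℚ K₁ = 2) (hK₁ : isCompact_glFiniteIntegralLevel 2 K₁)
    (P₁ : CuspidalAutomorphicRepData 2 K₁ hK₁) (hP₁ : IsPiOfArtinRep (ρ.restrictField K₁) P₁.1)
    (v₁ : HeightOneSpectrum (𝓞 ℚ)) (hunr₁ : Algebra.IsUnramifiedIn (𝓞 K₁) v₁.asIdeal)
    (hdeg₁ : ∀ w : HeightOneSpectrum (𝓞 K₁), w.asIdeal.under (𝓞 ℚ) = v₁.asIdeal →
      w.asIdeal.inertiaDeg (𝓞 ℚ) = 1)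
    (hcompat₁ : ∀ w : HeightOneSpectrum (𝓞 K₁), w.asIdeal.under (𝓞 ℚ) = v₁.asIdeal →
      FrobSatakeCompatibleAt (ρ.restrictField K₁) P₁.1 w)
    (hρ₁ : ρ.IsUnramifiedAt v₁) (hroots₁ : frobRoots ρ v₁ = {1, 1})
    (hQ : isCompact_glFiniteIntegralLevel 2 ℚ) :
    ∃ π πf : CuspidalAutomorphicRepData 2 ℚ hQ,
      IsWeakBaseChangeLiftAE π.1 P₁.1 ∧ π.1.HasSatakeParamAt v₁ {1, 1} ∧
      ∀ᶠ v : HeightOneSpectrum (𝓞 ℚ) in cofinite, ∀ α : Multiset ℂ,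
        π.1.HasSatakeParamAt v α → πf.1.HasSatakeParamAt v (α.map (quadraticSign K₁ v * ·)) := by
  -- (i) cyclic descent of `P₁` (its Satake data are `Gal(K₁/ℚ)`-stable)
  have hprime : (Module.finrank ℚ K₁).Prime := by rw [h2]; exact Nat.prime_two
  haveI : IsCyclic (K₁ ≃ₐ[ℚ] K₁) :=
    isCyclic_of_prime_card (p := Module.finrank ℚ K₁) (hp := ⟨hprime⟩)
      (IsGalois.card_aut_eq_finrank ℚ K₁)
  have hSU₁ : P₁.1.hasSatakeParamAt_unique := AutomorphicRepData.hasSatakeParamAt_unique_holds P₁.1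
  have hstab : IsGaloisStableSatakeAE ℚ P₁.1 :=
    isGaloisStableSatakeAE_of_isPiOfArtinRep ρ (eventually_isUnramifiedAt ρ) P₁.1 hSU₁ hP₁
  obtain ⟨π, hlift⟩ := hdesc 2 ℚ K₁ hQ hK₁ inferInstance hprime P₁ hstab
  -- (iii) the twist `π♭ = π ⊗ η_{K₁/ℚ}`
  obtain ⟨πf, htw⟩ := exists_twist_quadraticSign_holds 2 ℚ K₁ h2 hQ π
  refine ⟨π, πf, hlift, ?_, htw⟩
  -- (ii) the Satake parameter of `π` at `v₁` is `{1, 1}`: strong lifting at `w ∣ v₁`, `f(w|v₁) = 1`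
  obtain ⟨α₀, hα₀⟩ : π.1.IsUnramifiedAt v₁ :=
    hSL.isUnramifiedAt_of_forall hprime hlift hunr₁ fun w hw =>
      (hcompat₁ w hw).imp fun _ h => h.1
  obtain ⟨w, hw⟩ := exists_above (E := K₁) v₁
  have hPw := hSL.hasSatakeParamAt_pow hprime hlift hw hunr₁ hα₀
  obtain ⟨hβcard, hPv⟩ := card_frobRoots_and_hasFrobCharpolyAt ρ hρ₁
  have e := satakeParam_eq_frob_pow ρ hρ₁ hβcard hPv hSU₁ hw (hcompat₁ w hw) hPw
  rw [hdeg₁ w hw, hroots₁] at e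
  simp only [pow_one, Multiset.map_id'] at e
  rw [← e]
  exact hα₀

end Summit.Langlands.Langlands.Theorems.IcosahedralDescentLevel

end
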